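import Summits.CriticalPhenomena.PercolationContinuityZ3.Theorems.Transplant.CayleySkeletonAdm
import Summits.CriticalPhenomena.PercolationContinuityZ3.Theorems.Transplant.FreeNilpotentGroupNG
import HarnessLib

/-!
# `θ(p_c) = 0` on the LETTERS-ONLY Cayley graph `fnGraph m` of the free 2-step nilpotent group `N_{m,2}`, every `m ≥ 2`

builds on p205010 (kernel theorem, internal audit signed; external expert review pending).
Lane `prim-bschramm`, seat `prim-bschramm-p4` gen 10 (PART C3 of `P4-GENERAL.md`, "tier 2″").  Helper file
(`--supports stmt-CriticalPhenomena-4575 --as helper`).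

The tree's `fnGraph m = Cay(N_{m,2}; e_i^{±1})` (`FreeNilpotentGroup.lean`) — tier 2′'s named example (§27 (4)(b)): so far
`θ(p_c) = 0` for it was conditional on the `@[conjecture]` node `SamePDropOfSkeletonRank` (`freeNilpotent_criticalContinuity_of_dropNodeRank`).
Here it becomes UNCONDITIONAL (`fn_criticalContinuity`): the letters `S = {e_i^{±1}}` (as a `Finset` of the Mathlib group `FreeNilNG.NG m`)
carry a `CayleySign₁` — skeleton `φ = (x₀, x₁)`, `ν = signAut(−1)`, `κ = signAut(ε₁ = −1)`, and the CORNER-ADMISSIBLE kernel criterion: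
`ker φ = {x₀ = x₁ = 0}` is generated by the kernel letters `e_i^{±1}` (`i ≥ 2`) and the commutator words `a⁻¹b⁻¹ab = [a,b]` of letter
pairs with `φ a ≠ φ b ∈ {0, e₀, σe₁}`, which produce every basic commutator `E_q` (`comm_word`: `a⁻¹b⁻¹ab = (0, β(u,w) − β(w,u))`).
Finally `mulCayley ↑S = fnGraph m` (`mulCayley_Sg_eq`).
-/

noncomputable section

namespace Summit.CriticalPhenomena.PercolationContinuityZ3.Theorems.Transplant

namespace FreeNilLetters

open SimpleGraph Literature.Probability.LatticeModels Literature.Probability.Percolation FreeNilNG FreeNilNG.NG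
open scoped Classical

variable {m : ℕ}

/-! ## §1 The letters and the skeleton -/

/-- **The letters `S = {e_i^{±1}}`** as a `Finset` of the group `NG m`. [folklore] -/
def Sg (m : ℕ) : Finset (NG m) := (fnGens m).image of

/-- Membership in `S`. [folklore] -/
theorem mem_Sg {s : NG m} : s ∈ Sg m ↔ ∃ i : Fin m, s = of (fnGen i) ∨ s = of (fnGenInv i) := by
  simp only [Sg, Finset.mem_image, mem_fnGens_iff]
  constructor
  · rintro ⟨x, ⟨i, rfl | rfl⟩, rfl⟩
    · exact ⟨i, Or.inl rfl⟩
    · exact ⟨i, Or.inr rfl⟩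
  · rintro ⟨i, rfl | rfl⟩
    · exact ⟨fnGen i, ⟨i, Or.inl rfl⟩, rfl⟩
    · exact ⟨fnGenInv i, ⟨i, Or.inr rfl⟩, rfl⟩

/-- `(e_i)⁻¹ = e_i⁻¹` in `NG`. [folklore] -/
theorem of_fnGen_inv (i : Fin m) : (of (fnGen i) : NG m)⁻¹ = of (fnGenInv i) := val_injective (by simp)

/-- `(e_i⁻¹)⁻¹ = e_i` in `NG`. [folklore] -/
theorem of_fnGenInv_inv (i : Fin m) : (of (fnGenInv i) : NG m)⁻¹ = of (fnGen i) := by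
  rw [← of_fnGen_inv, inv_inv]

/-- `S` is symmetric. [folklore] -/
theorem inv_mem_Sg (s : NG m) (hs : s ∈ Sg m) : s⁻¹ ∈ Sg m := by
  obtain ⟨i, rfl | rfl⟩ := mem_Sg.1 hs
  · rw [of_fnGen_inv]; exact mem_Sg.2 ⟨i, Or.inr rfl⟩
  · rw [of_fnGenInv_inv]; exact mem_Sg.2 ⟨i, Or.inl rfl⟩

variable (m)

/-- **The planar skeleton `φ = (x₀, x₁)`** of `N_{m+2,2}`. [cite: KozmaNitzan2024, §4 p. 16 (Lemma 8)] -/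
def φ (g : NG (m + 2)) : Site 2 := fun j => if j = 0 then (val g).1 0 else (val g).1 1

variable {m}

/-- `φ` evaluated. [folklore] -/
@[simp] theorem φ_zero (g : NG (m + 2)) : φ m g 0 = (val g).1 0 := rfl

/-- `φ` evaluated. [folklore] -/
@[simp] theorem φ_one (g : NG (m + 2)) : φ m g 1 = (val g).1 1 := rfl

/-- `φ` is additive. [folklore] -/
theorem φ_mul (g h : NG (m + 2)) : φ m (g * h) = φ m g + φ m h := by
  funext j; fin_cases j <;> simp

/-- Heights of the letters have sup-norm `≤ 1`. [folklore] -/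
theorem lip_Sg (s : NG (m + 2)) (hs : s ∈ Sg (m + 2)) (j : Fin 2) : |φ m s j| ≤ 1 := by
  rcases mem_Sg.1 hs with ⟨i, rfl | rfl⟩
  · fin_cases j <;> simp [Pi.single_apply] <;> split_ifs <;> simp
  · fin_cases j <;> simp [Pi.single_apply] <;> split_ifs <;> simp

/-- `φ (e_0) = e₀`. [folklore] -/
theorem φ_gen0 : φ m (of (fnGen 0)) = Pi.single 0 1 := by funext j; fin_cases j <;> simp

/-- `φ (e_1) = e₁`. [folklore] -/
theorem φ_gen1 : φ m (of (fnGen 1)) = Pi.single 1 1 := by funext j; fin_cases j <;> simp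

/-- `φ (e_1⁻¹) = −e₁`. [folklore] -/
theorem φ_genInv1 : φ m (of (fnGenInv 1)) = -Pi.single 1 1 := by funext j; fin_cases j <;> simp

/-- `φ (e_i) = 0` for `i ≠ 0, 1`. [folklore] -/
theorem φ_gen_of_two_le (i : Fin (m + 2)) (h0 : i ≠ 0) (h1 : i ≠ 1) : φ m (of (fnGen i)) = 0 := by
  funext j; fin_cases j <;> simp [h0.symm, h1.symm]

/-- `φ (e_i⁻¹) = 0` for `i ≠ 0, 1`. [folklore] -/
theorem φ_genInv_of_two_le (i : Fin (m + 2)) (h0 : i ≠ 0) (h1 : i ≠ 1) : φ m (of (fnGenInv i)) = 0 := by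
  funext j; fin_cases j <;> simp [h0.symm, h1.symm]

/-! ## §2 Commutator words and the corner-admissible kernel criterion -/

/-- **The commutator word in `N_{m,2}`**: `a⁻¹ b⁻¹ a b = (0, β(u,w) − β(w,u))` for `a = (u,·)`, `b = (w,·)`. [folklore] -/
theorem comm_word (a b : NG m) : a⁻¹ * b⁻¹ * a * b = cen (fnBeta (val a).1 (val b).1 - fnBeta (val b).1 (val a).1) := by
  apply val_injective
  refine Prod.ext ?_ ?_
  · simp [cen, fnInv]
  · simp only [val_mul', val_inv, cen, val_of, fnMul_snd, fnMul_fst, fnInv, fnBeta_add_left, fnBeta_neg_left, fnBeta_neg_right]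
    abel

/-- The commutator word of two letters `e_i^{α}`, `e_j^{β}` with `i < j` is `E_{(i,j)}^{αβ}`. [folklore] -/
theorem comm_word_single {i j : Fin m} (hij : i < j) (α β : ℤ) :
    (of (Pi.single i α, (0 : Pr m → ℤ)) : NG m)⁻¹ * (of (Pi.single j β, (0 : Pr m → ℤ)))⁻¹ * of (Pi.single i α, 0) *
      of (Pi.single j β, 0) = cen (Pi.single ⟨(i, j), hij⟩ (α * β)) := by
  rw [comm_word]; simp [fnBeta_single_single i j α β hij, fnBeta_single_single_rev i j β α hij]

/-- The reversed version: letters `e_j^{β}`, `e_i^{α}` with `i < j` give `E_{(i,j)}^{−αβ}`. [folklore] -/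
theorem comm_word_single_rev {i j : Fin m} (hij : i < j) (α β : ℤ) :
    (of (Pi.single j β, (0 : Pr m → ℤ)) : NG m)⁻¹ * (of (Pi.single i α, (0 : Pr m → ℤ)))⁻¹ * of (Pi.single j β, 0) *
      of (Pi.single i α, 0) = cen (-Pi.single ⟨(i, j), hij⟩ (α * β)) := by
  rw [comm_word]; simp [fnBeta_single_single i j α β hij, fnBeta_single_single_rev i j β α hij]

/-- `e_i = (δ_i, 0)` and `e_i⁻¹ = (−δ_i, 0)` as signed singles. [folklore] -/
theorem of_fnGen_eq (i : Fin m) : (of (fnGen i) : NG m) = of (Pi.single i (1 : ℤ), 0) := rfl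

/-- `e_i⁻¹ = (−δ_i, 0)`. [folklore] -/
theorem of_fnGenInv_eq (i : Fin m) : (of (fnGenInv i) : NG m) = of (Pi.single i (-1 : ℤ), 0) := by
  apply val_injective; refine Prod.ext ?_ rfl; simp [← Pi.single_neg]

section Adm

variable {σ : ℤ} (hσ : σ = 1 ∨ σ = -1)
include hσ

/-- The closure of the admissible generators of sign `σ` (abbreviation). [folklore] -/
abbrev K (m : ℕ) (σ : ℤ) : Subgroup (NG (m + 2)) := Subgroup.closure (CayCyl.admGen (φ m) (Sg (m + 2)) σ)

omit hσ in
/-- Kernel letters lie in `K`. [folklore] -/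
theorem of_gen_mem_K (i : Fin (m + 2)) (h0 : i ≠ 0) (h1 : i ≠ 1) : (of (fnGen i) : NG (m + 2)) ∈ K m σ :=
  Subgroup.subset_closure (Or.inl ⟨mem_Sg.2 ⟨i, Or.inl rfl⟩, φ_gen_of_two_le i h0 h1⟩)

omit hσ in
/-- A commutator word of an admissible letter pair lies in `K`. [folklore] -/
theorem comm_mem_K {a b : NG (m + 2)} (ha : a ∈ Sg (m + 2)) (hb : b ∈ Sg (m + 2)) (hda : CayCyl.Dir σ (φ m a))
    (hdb : CayCyl.Dir σ (φ m b)) (hne : φ m a ≠ φ m b) : a⁻¹ * b⁻¹ * a * b ∈ K m σ :=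
  Subgroup.subset_closure (Or.inr ⟨a, ha, b, hb, hda, hdb, hne, rfl⟩)

/-- The letter `e_1^{σ}` of height `σ e₁`. [folklore] -/
theorem exists_sigma_letter : ∃ b : NG (m + 2), b ∈ Sg (m + 2) ∧ φ m b = σ • Pi.single 1 1 ∧ b = of (Pi.single 1 σ, 0) := by
  rcases hσ with rfl | rfl
  · exact ⟨of (fnGen 1), mem_Sg.2 ⟨1, Or.inl rfl⟩, by rw [φ_gen1, one_smul], of_fnGen_eq 1⟩
  · exact ⟨of (fnGenInv 1), mem_Sg.2 ⟨1, Or.inr rfl⟩, by rw [φ_genInv1, neg_smul, one_smul], of_fnGenInv_eq 1⟩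

/-- **Every basic commutator `E_q` lies in `K`.** [folklore] -/
theorem cen_single_mem_K (q : Pr (m + 2)) : (cen (Pi.single q 1) : NG (m + 2)) ∈ K m σ := by
  have hσ0 : (σ : ℤ) ≠ 0 := by rcases hσ with h | h <;> rw [h] <;> norm_num
  obtain ⟨⟨i, j⟩, hij⟩ := q
  obtain ⟨b, hb, hφb, hbe⟩ := exists_sigma_letter hσ
  have hdir0 : CayCyl.Dir σ (φ m (of (fnGen 0))) := Or.inr (Or.inl φ_gen0)
  have hdirb : CayCyl.Dir σ (φ m b) := Or.inr (Or.inr hφb)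
  have hne0b : φ m (of (fnGen 0)) ≠ φ m b := by
    rw [φ_gen0, hφb]; intro h; have := congrFun h 0; simp at this
  by_cases hi0 : i = 0
  · subst hi0
    by_cases hj1 : j = 1
    · subst hj1
      -- pair (e_0, e_1^σ): word = E_{01}^{σ}
      have h := comm_mem_K (mem_Sg.2 ⟨0, Or.inl rfl⟩) hb hdir0 hdirb hne0b
      rw [hbe, of_fnGen_eq, comm_word_single hij, one_mul] at h
      rcases hσ with rfl | rfl
      · exact h
      · have := (K m (-1)).inv_mem h
        rwa [cen_inv, ← Pi.single_neg, neg_neg] at this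
    · -- pair (e_0, e_j), j ≥ 2: word = E_{0j}
      have hj0 : j ≠ 0 := fun h => by subst h; exact lt_irrefl _ hij
      have hdirj : CayCyl.Dir σ (φ m (of (fnGen j))) := Or.inl (φ_gen_of_two_le j hj0 hj1)
      have hne : φ m (of (fnGen 0)) ≠ φ m (of (fnGen j)) := by
        rw [φ_gen0, φ_gen_of_two_le j hj0 hj1]; intro h; have := congrFun h 0; simp at this
      have h := comm_mem_K (mem_Sg.2 ⟨0, Or.inl rfl⟩) (mem_Sg.2 ⟨j, Or.inl rfl⟩) hdir0 hdirj hne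
      rwa [of_fnGen_eq, of_fnGen_eq, comm_word_single hij, one_mul] at h
  by_cases hi1 : i = 1
  · subst hi1
    -- pair (e_j, e_1^σ), j ≥ 2: word = E_{1j}^{-σ}
    have hj0 : j ≠ 0 := fun h => by subst h; exact absurd hij (not_lt.2 (Fin.zero_le _))
    have hj1 : j ≠ 1 := fun h => by subst h; exact lt_irrefl _ hij
    have hdirj : CayCyl.Dir σ (φ m (of (fnGen j))) := Or.inl (φ_gen_of_two_le j hj0 hj1)
    have hne : φ m (of (fnGen j)) ≠ φ m b := by
      rw [hφb, φ_gen_of_two_le j hj0 hj1]; intro h; have := congrFun h 1; simp [hσ0.symm] at this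
    have h := comm_mem_K (mem_Sg.2 ⟨j, Or.inl rfl⟩) hb hdirj hdirb hne
    rw [hbe, of_fnGen_eq, comm_word_single_rev hij, mul_one] at h
    rcases hσ with rfl | rfl
    · have := (K m 1).inv_mem h
      rwa [cen_inv, neg_neg] at this
    · rwa [← Pi.single_neg, neg_neg] at h
  -- i ≥ 2: E_{ij} = e_i e_j e_i⁻¹ e_j⁻¹, a product of kernel letters
  have hj0 : j ≠ 0 := fun h => by subst h; exact absurd hij (Fin.not_lt.2 (Fin.zero_le _))
  have hj1 : j ≠ 1 := by
    intro h; subst h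
    have : i.1 < 1 := hij
    interval_cases hv : i.1
    exact hi0 (Fin.ext hv)
  have e : (cen (Pi.single ⟨(i, j), hij⟩ 1) : NG (m + 2)) =
      of (fnGen i) * of (fnGen j) * (of (fnGen i))⁻¹ * (of (fnGen j))⁻¹ := by
    rw [of_fnGen_inv, of_fnGen_inv]
    exact val_injective (by rw [cen, val_of]; simp only [val_mul', val_of]; exact (fnGen_comm i j hij).symm)
  rw [e]
  exact (K m σ).mul_mem ((K m σ).mul_mem ((K m σ).mul_mem (of_gen_mem_K i hi0 hi1) (of_gen_mem_K j hj0 hj1))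
    ((K m σ).inv_mem (of_gen_mem_K i hi0 hi1))) ((K m σ).inv_mem (of_gen_mem_K j hj0 hj1))

/-- Central elements lie in `K`. [folklore] -/
theorem cen_mem_K (c : Pr (m + 2) → ℤ) : (cen c : NG (m + 2)) ∈ K m σ := by
  induction c using Pi.single_induction with
  | zero => rw [cen_zero]; exact Subgroup.one_mem _
  | add f g hf hg => rw [← cen_mul_cen]; exact Subgroup.mul_mem _ hf hg
  | single q a =>
    have := Subgroup.zpow_mem _ (cen_single_mem_K hσ q) a
    rwa [cen_zpow, ← Pi.single_smul, smul_eq_mul, mul_one] at this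

omit hσ in
/-- The product formula in coordinates. [folklore] -/
theorem of_mul_of (v w : Fin m → ℤ) (c c' : Pr m → ℤ) : (of (v, c) : NG m) * of (w, c') = of (v + w, c + c' + fnBeta v w) := rfl

omit hσ in
/-- Projection killing the two skeleton coordinates. [folklore] -/
def pr (v : Fin (m + 2) → ℤ) : Fin (m + 2) → ℤ := fun j => if j = 0 ∨ j = 1 then 0 else v j

omit hσ in
/-- `pr` is additive and `pr 0 = 0`. [folklore] -/
theorem pr_add (f g : Fin (m + 2) → ℤ) : pr (f + g) = pr f + pr g := by
  funext j; simp only [pr, Pi.add_apply]; split_ifs <;> simp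

/-- Every `(pr v, c)` lies in `K`. [folklore] -/
theorem of_pr_mem_K (v : Fin (m + 2) → ℤ) (c : Pr (m + 2) → ℤ) : (of (pr v, c) : NG (m + 2)) ∈ K m σ := by
  induction v using Pi.single_induction generalizing c with
  | zero =>
    have e : pr (0 : Fin (m + 2) → ℤ) = 0 := by funext j; simp [pr]
    rw [e, of_eq_mul_cen]; exact (K m σ).mul_mem (by exact (K m σ).one_mem) (cen_mem_K hσ c)
  | add f g hf hg =>
    have e : (of (pr (f + g), c) : NG (m + 2)) = of (pr f, 0) * of (pr g, c - fnBeta (pr f) (pr g)) := by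
      rw [of_mul_of, pr_add]; congr 1; simp
    rw [e]
    exact (K m σ).mul_mem (hf 0) (hg _)
  | single i a =>
    by_cases hi : i = 0 ∨ i = 1
    · have e : pr (Pi.single i a) = 0 := by
        funext j; simp only [pr, Pi.zero_apply]
        split_ifs with hj
        · rfl
        · rw [Pi.single_apply, if_neg]; rintro rfl; exact hj hi
      rw [e, of_eq_mul_cen]; exact (K m σ).mul_mem (by exact (K m σ).one_mem) (cen_mem_K hσ c)
    · push Not at hi
      have e : pr (Pi.single i a) = Pi.single i a := by
        funext j; simp only [pr]
        split_ifs with hj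
        · rw [Pi.single_apply, if_neg]; rintro rfl; rcases hj with h | h <;> [exact hi.1 h; exact hi.2 h]
        · rfl
      rw [e, of_eq_mul_cen]
      refine (K m σ).mul_mem ?_ (cen_mem_K hσ c)
      rw [← gen_zpow]
      exact (K m σ).zpow_mem (of_gen_mem_K i hi.1 hi.2) a

/-- **THE CORNER-ADMISSIBLE KERNEL CRITERION for `N_{m+2,2}` with letters only.** [folklore] -/
theorem ker_adm (g : NG (m + 2)) (hg : φ m g = 0) : g ∈ K m σ := by
  have h0 : (val g).1 0 = 0 := by simpa using congrFun hg 0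
  have h1 : (val g).1 1 = 0 := by simpa using congrFun hg 1
  have e : pr (val g).1 = (val g).1 := by
    funext j; simp only [pr]
    split_ifs with hj
    · rcases hj with rfl | rfl
      · exact h0.symm
      · exact h1.symm
    · rfl
  have := of_pr_mem_K hσ (val g).1 (val g).2
  rwa [e, show ((val g).1, (val g).2) = val g from rfl, of_val] at this

end Adm

/-! ## §3 The sign automorphisms preserve the letters -/

/-- **`signAut ε` preserves `S`.** [cite: KozmaNitzan2024, §4 p. 16 (Lemma 8)] -/
theorem signAut_mem_Sg (ε : Fin m → ℤˣ) (s : NG m) : signAut ε s ∈ Sg m ↔ s ∈ Sg m := by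
  suffices h : ∀ s : NG m, s ∈ Sg m → signAut ε s ∈ Sg m by
    refine ⟨fun hs => ?_, h s⟩
    have := h _ hs
    rwa [show signAut ε (signAut ε s) = s from val_injective (by simp [signMap_signMap])] at this
  intro s hs
  obtain ⟨x, hx, rfl⟩ := Finset.mem_image.1 hs
  exact Finset.mem_image.2 ⟨signMap ε x, signMap_mem_fnGens ε hx, rfl⟩

/-! ## §4 The `CayleySign₁` datum, the graph identification, and the theorem -/

/-- **THE `CayleySign₁` DATUM OF `fnGraph (m+2) = Cay(N_{m+2,2}; e_i^{±1})`.** [cite: KozmaNitzan2024, §4 p. 16 (Lemma 8)] [cite: BenjaminiSchramm1996, §2] -/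
def cayleySign₁ (m : ℕ) : CayleySign₁ (NG (m + 2)) (Sg (m + 2)) where
  φ := φ m
  map_mul := φ_mul
  lip := lip_Sg
  step := fun i => by
    fin_cases i
    · exact ⟨of (fnGen 0), mem_Sg.2 ⟨0, Or.inl rfl⟩, φ_gen0⟩
    · exact ⟨of (fnGen 1), mem_Sg.2 ⟨1, Or.inl rfl⟩, φ_gen1⟩
  inv_mem := inv_mem_Sg
  ν := signAut fun _ => -1
  ν_mem := signAut_mem_Sg _
  ν_φ := fun g => by funext j; fin_cases j <;> simp
  ker_adm := fun σ hσ g hg => ker_adm hσ g hg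
  κ := signAut fun i => if i = 1 then -1 else 1
  κ_mem := signAut_mem_Sg _
  κ_φ := fun g => by funext j; fin_cases j <;> simp [flipSnd]

/-- **`Cay(NG m; S) = fnGraph m`** (the tree's letters-only Cayley graph of `N_{m,2}`). [folklore] -/
theorem mulCayley_Sg_eq (m : ℕ) : mulCayley (↑(Sg m) : Set (NG m)) = (show SimpleGraph (NG m) from fnGraph m) := by
  ext x y
  rw [mulCayley_adj]
  show x ≠ y ∧ (x⁻¹ * y ∈ (↑(Sg m) : Set (NG m)) ∨ y⁻¹ * x ∈ (↑(Sg m) : Set (NG m))) ↔ (fnGraph m).Adj (val x) (val y)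
  rw [fnGraph_adj_iff]
  constructor
  · rintro ⟨hne, h | h⟩
    · obtain ⟨s, hs, he⟩ := Finset.mem_image.1 (Finset.mem_coe.1 h)
      refine ⟨s, hs, ?_⟩
      have : y = x * of s := by rw [he, mul_inv_cancel_left]
      rw [this]; rfl
    · obtain ⟨s, hs, he⟩ := Finset.mem_image.1 (Finset.mem_coe.1 h)
      obtain ⟨s', hs', hss'⟩ := exists_fnGens_mul_eq_zero hs
      refine ⟨s', hs', ?_⟩
      have hinv : (of s : NG m) * of s' = 1 := val_injective (by simpa using hss')
      have : y = x * of s' := by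
        have hx : x = y * of s := by rw [he, mul_inv_cancel_left]
        rw [hx, mul_assoc, hinv, mul_one]
      rw [this]; rfl
  · rintro ⟨s, hs, he⟩
    have hy : y = x * of s := val_injective (by simpa using he)
    refine ⟨fun hxy => ?_, Or.inl (Finset.mem_coe.2 (Finset.mem_image.2 ⟨s, hs, by rw [hy, inv_mul_cancel_left]⟩))⟩
    rw [hxy] at hy
    have hs1 : of s = (1 : NG m) := (mul_eq_left.1 hy.symm)
    have hs0 : s = 0 := congrArg val hs1
    obtain ⟨i, rfl | rfl⟩ := (mem_fnGens_iff s).1 hs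
    · have := congrArg (fun z : FN m => z.1 i) hs0; simp at this
    · have := congrArg (fun z : FN m => z.1 i) hs0; simp at this

/-- **THEOREM (tier 2″, unconditional): `θ_v(p_c) = 0` at every vertex of `fnGraph (m+2) = Cay(N_{m+2,2}; e_i^{±1})`, every `m`** —
the letters-only Cayley graph of the free 2-step nilpotent group of every rank `≥ 2`, so far conditional on `SamePDropOfSkeletonRank`.
builds on p205010 (kernel theorem, internal audit signed; external expert review pending).
[cite: BenjaminiSchramm1996, Conj. 4] [cite: AizenmanGrimmett1991, Thm 1] [cite: KozmaNitzan2024, §1 p. 2 (approach 1)] -/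
theorem fn_criticalContinuity (m : ℕ) (v : FN (m + 2)) : theta (fnGraph (m + 2)) v (criticalProbIOf (fnGraph (m + 2)) v) = 0 := by
  have h := (cayleySign₁ m).theta_eq_zero_of_le (of v) (p := criticalProbIOf (mulCayley (↑(Sg (m + 2)) : Set (NG (m + 2)))) (of v))
    le_rfl
  rw [mulCayley_Sg_eq] at h
  exact h

/-- The same for every rank `m ≥ 2`. [cite: BenjaminiSchramm1996, Conj. 4] -/
theorem fn_criticalContinuity' {m : ℕ} (hm : 2 ≤ m) (v : FN m) : theta (fnGraph m) v (criticalProbIOf (fnGraph m) v) = 0 := by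
  obtain ⟨k, rfl⟩ := Nat.exists_eq_add_of_le' hm
  exact fn_criticalContinuity k v

end FreeNilLetters

end Summit.CriticalPhenomena.PercolationContinuityZ3.Theorems.Transplant

end
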